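import Literature.Analysis.SpecialFunctions.ExpFDeriv
import Mathlib.Analysis.Calculus.MeanValue
import HarnessLib

/-!
# R3 (cell `ym3-torus`, YM₃ on T³ — a ladder RUNG, NOT d = 4, NOT infinite volume, NOT a mass gap, NOT the Clay problem) —
# **(H_K ∀-L, brick B1) THE FRÉCHET DERIVATIVE OF `exp` IS LIPSCHITZ ON BALLS OF A COMPLETE NORMED ALGEBRA: `‖D exp(x) − D exp(y)‖ ≤ e^{R}·‖x − y‖`,
# `‖D exp(x) − id‖ ≤ e^{‖x‖} − 1` (floor `(2 − e^{‖x‖})‖h‖ ≤ ‖D exp(x) h‖`), `‖exp x − exp y‖ ≤ e^{R}‖x − y‖`**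

Width seat `ym-ust-19936-w8` g13 on crux `stmt-QuantumFields-19936` `UnitScaleTilt.HistoryTailL` (`--supports`, helper; THEOREMS ONLY, 0 `def`, 0 `sorry`).
[folklore] normed-algebra calculus over lit ✓`Literature.Analysis.SpecialFunctions.ExpFDeriv` (the derivative SERIES `D exp(x) = Σₙ term x n`,
`term x n h = (n!)⁻¹ Σ_{i<n} x^{n−1−i} h xⁱ`, `‖term x n‖ ≤ n R^{n−1}∕n!`, `Σₙ n R^{n−1}∕n! = e^R`), Mathlib-only otherwise; scalars `ℝ`.

WHY (the located gap, numbers not adjectives).  hTop(F) — the top block-averaging push-forward bound of the 19936 supply chain — is a tree theorem for every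
T³ family with `F.L ≤ 20` (✓`UV3BranchExpansionHTopT3AllL`, consumers ✓`UV3HTopConsumersLeTwenty`); the crux `HistoryTailL` quantifies EVERY odd `L > 1`.  The one
missing input for `L ≥ 21` is an EXPLICIT level-uniform (H_K) fibre-law constant for print's `SU(2)` exp-mean-log average (my lineage's ✓`UV3BranchExpansionSocketWeightsSU`
HYP-SAT: «NOT supplied here»; n08 LOCATE-g48 §1).  The agreed road (LOCATE-g48 §5, px8 g14 ∕ dag-n08-d g48 2026-08-30): local injectivity of the fibre map on chart
balls of radius `∝ (1 − Σcᵢ) = L^{1−d}` from the derivative floor (tree, every `Σcᵢ ≤ 1`) and a LIPSCHITZ BOUND ON THE DERIVATIVE (tree ✓`injOn_of_norm_fderiv_sub_le_of_sub`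
eats exactly that), an explicit window net, the multi-window frame ✓`…GuardChartTransfer.haar_map_le_of_windows`.  The fibre map is `k(u) = exp(Y(u))·u`,
`Y(u) = Σcᵢ qlog(aᵢū)`, `D qlog = (D exp ∘ qlog)⁻¹`: every Lipschitz constant downstream is built from THIS file's three inequalities.

CONTENTS.  §1 `norm_pow_sub_pow_le` (`‖xᵃ − yᵃ‖ ≤ aR^{a−1}‖x − y‖`).  §2 `norm_pow_mul_mul_pow_sub_le` (`‖xᵃhxᵇ − yᵃhyᵇ‖ ≤ (a+b)R^{a+b−1}‖x−y‖‖h‖`).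
§3 `norm_term_sub_term_le` (`‖term x n − term y n‖ ≤ n(n−1)R^{n−2}‖x−y‖∕n!`) · `hasSum_bound₂` (`Σₙ n(n−1)R^{n−2}∕n! = e^R`).
§4 ★ `norm_fderiv_exp_sub_le` (`‖D exp(x) − D exp(y)‖ ≤ e^R‖x − y‖` on `‖x‖, ‖y‖ ≤ R`).  §5 `term_one` · ★ `norm_fderiv_exp_sub_id_le` (`‖D exp(x) − id‖ ≤ e^{‖x‖} − 1`) ·
`norm_le_norm_fderiv_exp_apply` (floor `(2 − e^{‖x‖})‖h‖ ≤ ‖D exp(x) h‖`) · `norm_fderiv_exp_le'` (`‖D exp(x)‖ ≤ e^{‖x‖}`, the lit bound in `fderiv` letters).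
§6 `norm_exp_sub_exp_le_of_norm_le` (`‖exp x − exp y‖ ≤ e^R‖x − y‖`, mean value inequality on the closed ball).

DEDUP (searched 2026-08-30).  `ℂ`-algebra editions of §1∕§6 exist in the tree (`…T4Continuum.Support.ShellMeasureExpLipschitz.norm_pow_sub_pow_le`,
lit `B9Eq373TransporterLipschitzLetters.norm_exp_sub_exp_le_of_norm_le`, both under `[NormedAlgebra ℂ 𝔸]`); the quaternions `ℍ` are an `ℝ`-algebra and NOT a
`ℂ`-algebra, so the `ℝ`-scalar editions below are needed (different fully-qualified names); no Lipschitz bound for `D exp` exists in the tree.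

HONEST SCOPE.  Pure calculus; nothing of (H_K) at `L ≥ 21`, hTop, the χ record, (O‴χₛ), EX, `HistoryTailL` (19936) or any summit statement is proved here; hTop is
SUPPLY w.r.t. the registered 19936 v6 door (★★OWNER WORD 98), not a registry row.  YM₃ on T³ is rung R3 of the ladder — NOT d = 4, NOT infinite volume, NOT a mass gap,
NOT the Clay problem; the Yang–Mills mass gap is NOT proved by any of this.

References (orientation only; every declaration is kernel-proved [folklore]): D. S. Bernstein, *Matrix Mathematics* (2nd ed., 2009), Fact 11.14.3 (the derivative of the
matrix exponential); T. Bałaban, Commun. Math. Phys. **109** (1987) 249–301 [Balaban1987RG1] ((0.4) p. 253 — the averaging whose one-variable law is `k`).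
-/

set_option autoImplicit false

noncomputable section

open NormedSpace Filter Topology Set Metric
open scoped Nat

namespace Summit.QuantumFields.YangMills.Theorems.UV3ExpFDerivLipschitz

open Literature.Analysis.SpecialFunctions
open Literature.Analysis.SpecialFunctions.ExpFDeriv (term term_apply term_zero norm_term_le hasSum_bound summable_term fderiv_exp
  norm_fderiv_exp_le hasFDerivAt_exp)

variable {𝔸 : Type*} [NormedRing 𝔸] [NormedAlgebra ℝ 𝔸] [NormOneClass 𝔸]

/-! ## §1 Powers -/

omit [NormedAlgebra ℝ 𝔸] in
/-- `‖xᵃ − yᵃ‖ ≤ a·R^{a−1}·‖x − y‖` for `‖x‖, ‖y‖ ≤ R` in a normed algebra with `‖1‖ = 1` (telescoping). [folklore] -/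
theorem norm_pow_sub_pow_le {R : ℝ} {x y : 𝔸} (hx : ‖x‖ ≤ R) (hy : ‖y‖ ≤ R) (a : ℕ) :
    ‖x ^ a - y ^ a‖ ≤ a * R ^ (a - 1) * ‖x - y‖ := by
  have hR : 0 ≤ R := (norm_nonneg _).trans hx
  induction a with
  | zero => simp
  | succ a ih =>
    have e : x ^ (a + 1) - y ^ (a + 1) = x ^ a * (x - y) + (x ^ a - y ^ a) * y := by
      rw [pow_succ, pow_succ]; noncomm_ring
    rw [e]
    have h1 : ‖x ^ a * (x - y)‖ ≤ R ^ a * ‖x - y‖ :=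
      (norm_mul_le _ _).trans (mul_le_mul_of_nonneg_right ((norm_pow_le x a).trans (pow_le_pow_left₀ (norm_nonneg _) hx a)) (norm_nonneg _))
    have h2 : ‖(x ^ a - y ^ a) * y‖ ≤ (a * R ^ (a - 1) * ‖x - y‖) * R :=
      (norm_mul_le _ _).trans (mul_le_mul ih hy (norm_nonneg _) (by positivity))
    refine ((norm_add_le _ _).trans (add_le_add h1 h2)).trans (le_of_eq ?_)
    rcases a with _ | a
    · simp
    · rw [Nat.add_sub_cancel, Nat.add_sub_cancel, pow_succ]; push_cast; ring

/-! ## §2 One summand of the derivative term -/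

omit [NormedAlgebra ℝ 𝔸] in
/-- `‖xᵃ·h·xᵇ − yᵃ·h·yᵇ‖ ≤ (a + b)·R^{a+b−1}·‖x − y‖·‖h‖` for `‖x‖, ‖y‖ ≤ R`. [folklore] -/
theorem norm_pow_mul_mul_pow_sub_le {R : ℝ} {x y : 𝔸} (hx : ‖x‖ ≤ R) (hy : ‖y‖ ≤ R) (h : 𝔸) (a b : ℕ) :
    ‖x ^ a * h * x ^ b - y ^ a * h * y ^ b‖ ≤ (a + b) * R ^ (a + b - 1) * ‖x - y‖ * ‖h‖ := by
  have hR : 0 ≤ R := (norm_nonneg _).trans hx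
  have e : x ^ a * h * x ^ b - y ^ a * h * y ^ b = (x ^ a - y ^ a) * h * x ^ b + y ^ a * h * (x ^ b - y ^ b) := by
    noncomm_ring
  rw [e]
  have hxb : ‖x ^ b‖ ≤ R ^ b := (norm_pow_le x b).trans (pow_le_pow_left₀ (norm_nonneg _) hx b)
  have hya : ‖y ^ a‖ ≤ R ^ a := (norm_pow_le y a).trans (pow_le_pow_left₀ (norm_nonneg _) hy a)
  have h1 : ‖(x ^ a - y ^ a) * h * x ^ b‖ ≤ (a * R ^ (a - 1) * ‖x - y‖) * ‖h‖ * R ^ b :=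
    calc ‖(x ^ a - y ^ a) * h * x ^ b‖ ≤ ‖x ^ a - y ^ a‖ * ‖h‖ * ‖x ^ b‖ :=
          (norm_mul_le _ _).trans (mul_le_mul_of_nonneg_right (norm_mul_le _ _) (norm_nonneg _))
      _ ≤ (a * R ^ (a - 1) * ‖x - y‖) * ‖h‖ * R ^ b := by
          gcongr
          exact norm_pow_sub_pow_le hx hy a
  have h2 : ‖y ^ a * h * (x ^ b - y ^ b)‖ ≤ R ^ a * ‖h‖ * (b * R ^ (b - 1) * ‖x - y‖) :=
    calc ‖y ^ a * h * (x ^ b - y ^ b)‖ ≤ ‖y ^ a‖ * ‖h‖ * ‖x ^ b - y ^ b‖ :=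
          (norm_mul_le _ _).trans (mul_le_mul_of_nonneg_right (norm_mul_le _ _) (norm_nonneg _))
      _ ≤ R ^ a * ‖h‖ * (b * R ^ (b - 1) * ‖x - y‖) := by
          gcongr
          exact norm_pow_sub_pow_le hx hy b
  have key : (a : ℝ) * R ^ (a - 1) * R ^ b + R ^ a * (b * R ^ (b - 1)) = (a + b) * R ^ (a + b - 1) := by
    rcases Nat.eq_zero_or_pos a with rfl | ha
    · simp
    rcases Nat.eq_zero_or_pos b with rfl | hb
    · simp
    have e1 : R ^ (a - 1) * R ^ b = R ^ (a + b - 1) := by rw [← pow_add]; congr 1; omega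
    have e2 : R ^ a * R ^ (b - 1) = R ^ (a + b - 1) := by rw [← pow_add]; congr 1; omega
    calc (a : ℝ) * R ^ (a - 1) * R ^ b + R ^ a * (b * R ^ (b - 1))
        = a * (R ^ (a - 1) * R ^ b) + b * (R ^ a * R ^ (b - 1)) := by ring
      _ = (a + b) * R ^ (a + b - 1) := by rw [e1, e2]; ring
  calc ‖(x ^ a - y ^ a) * h * x ^ b + y ^ a * h * (x ^ b - y ^ b)‖
      ≤ (a * R ^ (a - 1) * ‖x - y‖) * ‖h‖ * R ^ b + R ^ a * ‖h‖ * (b * R ^ (b - 1) * ‖x - y‖) :=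
        (norm_add_le _ _).trans (add_le_add h1 h2)
    _ = ((a : ℝ) * R ^ (a - 1) * R ^ b + R ^ a * (b * R ^ (b - 1))) * ‖x - y‖ * ‖h‖ := by ring
    _ = (a + b) * R ^ (a + b - 1) * ‖x - y‖ * ‖h‖ := by rw [key]

/-! ## §3 The term difference and its bounding series -/

/-- `‖term x n − term y n‖ ≤ n(n−1)R^{n−2}‖x − y‖∕n!` for `‖x‖, ‖y‖ ≤ R`. [folklore] -/
theorem norm_term_sub_term_le {R : ℝ} {x y : 𝔸} (hx : ‖x‖ ≤ R) (hy : ‖y‖ ≤ R) (n : ℕ) :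
    ‖term ℝ x n - term ℝ y n‖ ≤ (n ! : ℝ)⁻¹ * (n * ((n - 1 : ℕ) : ℝ) * R ^ (n - 2)) * ‖x - y‖ := by
  have hR : 0 ≤ R := (norm_nonneg _).trans hx
  refine ContinuousLinearMap.opNorm_le_bound _ (by positivity) fun h => ?_
  rw [sub_apply, term_apply, term_apply, ← smul_sub, ← Finset.sum_sub_distrib, norm_smul, norm_inv,
    Real.norm_natCast]
  have hsum : ‖∑ i ∈ Finset.range n, (x ^ (n.pred - i) * h * x ^ i - y ^ (n.pred - i) * h * y ^ i)‖ ≤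
      n * ((n - 1 : ℕ) : ℝ) * R ^ (n - 2) * ‖x - y‖ * ‖h‖ := by
    calc ‖∑ i ∈ Finset.range n, (x ^ (n.pred - i) * h * x ^ i - y ^ (n.pred - i) * h * y ^ i)‖
        ≤ ∑ i ∈ Finset.range n, ‖x ^ (n.pred - i) * h * x ^ i - y ^ (n.pred - i) * h * y ^ i‖ := norm_sum_le _ _
      _ ≤ ∑ i ∈ Finset.range n, ((n - 1 : ℕ) : ℝ) * R ^ (n - 2) * ‖x - y‖ * ‖h‖ := by
          refine Finset.sum_le_sum fun i hi => ?_
          have hi' : i < n := Finset.mem_range.1 hi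
          have hab : n.pred - i + i = n - 1 := by rw [Nat.pred_eq_sub_one]; omega
          have h := norm_pow_mul_mul_pow_sub_le hx hy h (n.pred - i) i
          rw [hab, show n - 1 - 1 = n - 2 by omega] at h
          have hcast : ((n.pred - i : ℕ) : ℝ) + (i : ℝ) = ((n - 1 : ℕ) : ℝ) := by exact_mod_cast hab
          rw [hcast] at h
          exact h
      _ = n * ((n - 1 : ℕ) : ℝ) * R ^ (n - 2) * ‖x - y‖ * ‖h‖ := by
          rw [Finset.sum_const, Finset.card_range, nsmul_eq_mul]; ring
  calc (n ! : ℝ)⁻¹ * ‖∑ i ∈ Finset.range n, (x ^ (n.pred - i) * h * x ^ i - y ^ (n.pred - i) * h * y ^ i)‖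
      ≤ (n ! : ℝ)⁻¹ * (n * ((n - 1 : ℕ) : ℝ) * R ^ (n - 2) * ‖x - y‖ * ‖h‖) :=
        mul_le_mul_of_nonneg_left hsum (by positivity)
    _ = (n ! : ℝ)⁻¹ * (n * ((n - 1 : ℕ) : ℝ) * R ^ (n - 2)) * ‖x - y‖ * ‖h‖ := by ring

/-- The bounding sequence `n(n−1)R^{n−2}∕n!` (`= R^{n−2}∕(n−2)!`) has sum `e^R`. [folklore] -/
theorem hasSum_bound₂ (R : ℝ) :
    HasSum (fun n : ℕ => (n ! : ℝ)⁻¹ * (n * ((n - 1 : ℕ) : ℝ) * R ^ (n - 2))) (Real.exp R) := by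
  set f : ℕ → ℝ := fun n => (n ! : ℝ)⁻¹ * (n * ((n - 1 : ℕ) : ℝ) * R ^ (n - 2)) with hf
  have h1 : HasSum (fun n : ℕ => R ^ n / n !) (Real.exp R) := by
    rw [congr_fun Real.exp_eq_exp_ℝ R]
    exact expSeries_div_hasSum_exp R
  have h2 : (fun n : ℕ => f (n + 2)) = fun n => R ^ n / n ! := by
    funext n
    simp only [hf]
    rw [show n + 2 - 1 = n + 1 by omega, show n + 2 - 2 = n by omega, Nat.factorial_succ, Nat.factorial_succ]
    push_cast
    have hn : (n ! : ℝ) ≠ 0 := by positivity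
    field_simp
    ring
  have h0 : ∑ i ∈ Finset.range 2, f i = 0 := by simp [hf, Finset.sum_range_succ]
  have h3 : HasSum (fun n : ℕ => f (n + 2)) (Real.exp R - ∑ i ∈ Finset.range 2, f i) := by
    rw [h0, sub_zero, h2]; exact h1
  exact (hasSum_nat_add_iff' 2).1 h3

/-! ## §4 ★ The Lipschitz bound of the derivative -/

variable [CompleteSpace 𝔸]

/-- ★ **THE FRÉCHET DERIVATIVE OF `exp` IS LIPSCHITZ ON BALLS**: `‖D exp(x) − D exp(y)‖ ≤ e^{R}·‖x − y‖` for `‖x‖, ‖y‖ ≤ R` in a complete normed `ℝ`-algebra with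
`‖1‖ = 1` (termwise on the derivative series of lit `ExpFDeriv`). [folklore] -/
theorem norm_fderiv_exp_sub_le {R : ℝ} {x y : 𝔸} (hx : ‖x‖ ≤ R) (hy : ‖y‖ ≤ R) :
    ‖fderiv ℝ (exp : 𝔸 → 𝔸) x - fderiv ℝ (exp : 𝔸 → 𝔸) y‖ ≤ Real.exp R * ‖x - y‖ := by
  rw [fderiv_exp ℝ x, fderiv_exp ℝ y, ← (summable_term ℝ x).tsum_sub (summable_term ℝ y)]
  exact tsum_of_norm_bounded ((hasSum_bound₂ R).mul_right ‖x - y‖) fun n => norm_term_sub_term_le hx hy n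

/-! ## §5 Distance to the identity and the derivative floor -/

omit [CompleteSpace 𝔸] [NormOneClass 𝔸] in
/-- The first term of the derivative series is the identity: `term x 1 = id`. [folklore] -/
theorem term_one (x : 𝔸) : term ℝ x 1 = ContinuousLinearMap.id ℝ 𝔸 := by
  ext h
  simp [term_apply]

/-- ★ `‖D exp(x) − id‖ ≤ e^{‖x‖} − 1` (the series without its first two terms). [folklore] -/
theorem norm_fderiv_exp_sub_id_le (x : 𝔸) :
    ‖fderiv ℝ (exp : 𝔸 → 𝔸) x - ContinuousLinearMap.id ℝ 𝔸‖ ≤ Real.exp ‖x‖ - 1 := by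
  rw [fderiv_exp ℝ x]
  have hs := summable_term ℝ x
  have hsplit : (∑ i ∈ Finset.range 2, term ℝ x i) + ∑' i, term ℝ x (i + 2) = ∑' i, term ℝ x i := hs.sum_add_tsum_nat_add 2
  have h01 : ∑ i ∈ Finset.range 2, term ℝ x i = ContinuousLinearMap.id ℝ 𝔸 := by
    simp [Finset.sum_range_succ, term_one]
  rw [← hsplit, h01, add_sub_cancel_left]
  have hb := (hasSum_nat_add_iff' 2).2 (hasSum_bound ‖x‖)
  have hb01 : ∑ i ∈ Finset.range 2, ((i ! : ℝ)⁻¹ * (i * ‖x‖ ^ (i - 1))) = 1 := by simp [Finset.sum_range_succ]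
  rw [hb01] at hb
  exact tsum_of_norm_bounded hb fun n => norm_term_le ℝ le_rfl (n + 2)

/-- **THE DERIVATIVE FLOOR NEAR `0`**: `(2 − e^{‖x‖})·‖h‖ ≤ ‖D exp(x) h‖` (useful for `‖x‖ < log 2`). [folklore] -/
theorem norm_le_norm_fderiv_exp_apply (x h : 𝔸) :
    (2 - Real.exp ‖x‖) * ‖h‖ ≤ ‖fderiv ℝ (exp : 𝔸 → 𝔸) x h‖ := by
  have h1 : ‖h‖ ≤ ‖fderiv ℝ (exp : 𝔸 → 𝔸) x h‖ + ‖(fderiv ℝ (exp : 𝔸 → 𝔸) x - ContinuousLinearMap.id ℝ 𝔸) h‖ := by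
    have e : h = fderiv ℝ (exp : 𝔸 → 𝔸) x h - (fderiv ℝ (exp : 𝔸 → 𝔸) x - ContinuousLinearMap.id ℝ 𝔸) h := by
      simp
    calc ‖h‖ = ‖fderiv ℝ (exp : 𝔸 → 𝔸) x h - (fderiv ℝ (exp : 𝔸 → 𝔸) x - ContinuousLinearMap.id ℝ 𝔸) h‖ := by rw [← e]
      _ ≤ _ := norm_sub_le _ _
  have h2 : ‖(fderiv ℝ (exp : 𝔸 → 𝔸) x - ContinuousLinearMap.id ℝ 𝔸) h‖ ≤ (Real.exp ‖x‖ - 1) * ‖h‖ :=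
    (ContinuousLinearMap.le_opNorm _ _).trans (mul_le_mul_of_nonneg_right (norm_fderiv_exp_sub_id_le x) (norm_nonneg _))
  linarith

/-- The lit bound in `fderiv` letters: `‖D exp(x)‖ ≤ e^{‖x‖}`. [folklore] -/
theorem norm_fderiv_exp_le' (x : 𝔸) : ‖fderiv ℝ (exp : 𝔸 → 𝔸) x‖ ≤ Real.exp ‖x‖ := by
  rw [fderiv_exp ℝ x]; exact norm_fderiv_exp_le ℝ x

/-! ## §6 `exp` is Lipschitz on balls -/

/-- `‖exp x − exp y‖ ≤ e^{R}·‖x − y‖` for `‖x‖, ‖y‖ ≤ R` (mean value inequality on the closed ball, `‖D exp(z)‖ ≤ e^{‖z‖} ≤ e^R`). [folklore] -/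
theorem norm_exp_sub_exp_le_of_norm_le {R : ℝ} {x y : 𝔸} (hx : ‖x‖ ≤ R) (hy : ‖y‖ ≤ R) :
    ‖exp x - exp y‖ ≤ Real.exp R * ‖x - y‖ := by
  have hconv : Convex ℝ (closedBall (0 : 𝔸) R) := convex_closedBall _ _
  have hder : ∀ z ∈ closedBall (0 : 𝔸) R, HasFDerivWithinAt (exp : 𝔸 → 𝔸) (fderiv ℝ (exp : 𝔸 → 𝔸) z) (closedBall (0 : 𝔸) R) z :=
    fun z _ => ((hasFDerivAt_exp ℝ z).hasFDerivWithinAt).congr_fderiv (fderiv_exp ℝ z).symm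
  have hbound : ∀ z ∈ closedBall (0 : 𝔸) R, ‖fderiv ℝ (exp : 𝔸 → 𝔸) z‖ ≤ Real.exp R := fun z hz =>
    (norm_fderiv_exp_le' z).trans (Real.exp_le_exp.2 (mem_closedBall_zero_iff.1 hz))
  have h := hconv.norm_image_sub_le_of_norm_hasFDerivWithin_le hder hbound (mem_closedBall_zero_iff.2 hy) (mem_closedBall_zero_iff.2 hx)
  exact h

end Summit.QuantumFields.YangMills.Theorems.UV3ExpFDerivLipschitz

end
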